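import Summits.AnomalousDissipation.AnomalousDissipation.Theorems.SteadyCoherentFractionRootsPlanarWitnessDefect
import Literature.Analysis.FluidPDE.LerayHopfSliceZeroTorus
import HarnessLib

/-!
# Junk-model fact for the «ejection» items: the time-zero slice of `Torus.IsGlobalLerayHopf` is free

Negative-lane record (decomp-ad crit-1 g23; refuter role, step 6(ii) «junk model»), supporting item
stmt-AnomalousDissipation-30314 `SymmetricOrLoud.PlanarStatesEject` and its siblings 30320 / 31392 / 31393 /
31394 / 32462.  In the tree's `Torus.IsGlobalLerayHopf ν f u₀ u` the slice `u 0` is constrained only by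
`u 0 ∈ L²` and `½‖u 0‖² ≤ ½‖u₀‖²` (`Torus.IsGlobalLerayHopf.congr_of_eqOn_Ioi`,
`Literature/Analysis/FluidPDE/LerayHopfSliceZeroTorus.lean`): every other clause of `IsLerayHopfOn` lives on
`(0, T]`.  `sliceZero_eject` makes this quantitative in the currency of the lens-4 ejection items: for EVERY
global Leray–Hopf solution `v` from an `L²` datum `v₀` of positive energy (any viscosity, any force) there is a
global Leray–Hopf solution `u` from the same datum, equal to `v` for `t ≠ 0`, whose time-zero slice
`u 0 = c • vfield` (the crossed-shear field of `CrossedShearRoot`, `c² = ∫‖v₀‖²/16`) has planar-symmetry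
defect `≥ (c_K²/256) · ∫‖u 0‖² > 0`.  Consequently any statement concluding
`∃ u, IsGlobalLerayHopf ν f u₀ u ∧ ∃ t : ℝ, 0 ≤ t ∧ 0 < defect (u t) ∧ c₀ ∫‖u t‖² ≤ defect (u t)` with
`c₀ ≤ c_K²/256` holds for the junk reason (witness `t = 0`); the honest form quantifies `0 < t` (slices at
`t > 0` are pinned by the weak-continuity clause).  This file deliberately references NO `Theses` declaration,
so it survives their restatement; the item-level certificate (the six decls proved as typed) is evidence on the
items, not a tree file.

Contents: `half_le_rho`, `abs_cK_le`, `norm_vfield_le`, `integral_norm_sq_vfield_le` (size of the crossed-shear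
field), `defect_smul_vfield_ge`, `defect_iInf_smul_vfield_ge` (its defect, from `CrossedShearRoot.defect_vfield_ge`),
`sliceZero_eject` (the junk-model fact), `c0_pos`.
-/

noncomputable section

set_option linter.dupNamespace false

namespace Summit.AnomalousDissipation.AnomalousDissipation.Theorems.SymmetricOrLoudPlanarStatesEject.Negative

open MeasureTheory Real Function
open scoped InnerProductSpace
open Literature.Analysis.FluidPDE Literature.Analysis.FluidPDE.Torus
open Literature.Analysis.FunctionSpaces Literature.Analysis.FunctionSpaces.Torus
open Summit.AnomalousDissipation.AnomalousDissipation.Theorems.CrossedShearRoot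

/-! ## §1 The junk slice: the scaled crossed-shear field -/

/-- `ρ ≥ ½`. [folklore] -/
theorem half_le_rho (t : ℝ) : 1 / 2 ≤ rho t := by
  unfold rho
  have := Real.neg_one_le_cos (2 * Real.pi * t)
  linarith

/-- `|c_K| ≤ 1/12`. [folklore] -/
theorem abs_cK_le : |cK| ≤ 1 / 12 := by
  unfold cK
  rw [abs_neg, abs_of_pos (by positivity)]
  rw [div_le_div_iff₀ (by positivity) (by norm_num)]
  nlinarith [Real.pi_gt_three]

/-- Pointwise bound `‖v(x)‖ ≤ 4`. [folklore] -/
theorem norm_vfield_le (x : UnitAddTorus (Fin 3)) : ‖vfield x‖ ≤ 4 := by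
  have h0 : |V0 x| ≤ 2 := by
    unfold V0
    rw [abs_div]
    have hρ : 1 / 2 ≤ rho (repr x 2) := half_le_rho _
    have hρ' : |rho (repr x 2)| = rho (repr x 2) := abs_of_pos (by linarith)
    rw [hρ', div_le_iff₀ (by linarith)]
    have hc : |c4 (repr x 1)| ≤ 1 := by unfold c4; exact Real.abs_cos_le_one _
    linarith
  have h1 : |V1 x| ≤ 2 := by
    unfold V1
    have hc : |c4 (repr x 0)| ≤ 1 := by unfold c4; exact Real.abs_cos_le_one _
    have hρ : 1 / 2 ≤ rho (repr x 2) := half_le_rho _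
    have hρ2 : rho (repr x 2) ≤ 3 / 2 := (rho_profile_pos _).2
    have hK := abs_cK_le
    have e1 : |(c4 (repr x 0) + cK) * rho (repr x 2)| ≤ (1 + 1 / 12) * (3 / 2) := by
      rw [abs_mul, abs_of_pos (by linarith : (0 : ℝ) < rho (repr x 2))]
      exact mul_le_mul ((abs_add_le _ _).trans (by linarith)) hρ2 (by linarith) (by norm_num)
    calc |(c4 (repr x 0) + cK) * rho (repr x 2) - cK|
        ≤ |(c4 (repr x 0) + cK) * rho (repr x 2)| + |cK| := abs_sub _ _
      _ ≤ (1 + 1 / 12) * (3 / 2) + 1 / 12 := add_le_add e1 hK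
      _ ≤ 2 := by norm_num
  unfold vfield
  calc ‖V0 x • EuclideanSpace.single (0 : Fin 3) (1 : ℝ) + V1 x • EuclideanSpace.single (1 : Fin 3) (1 : ℝ)‖
      ≤ ‖V0 x • EuclideanSpace.single (0 : Fin 3) (1 : ℝ)‖ + ‖V1 x • EuclideanSpace.single (1 : Fin 3) (1 : ℝ)‖ :=
        norm_add_le _ _
    _ = |V0 x| + |V1 x| := by simp [norm_smul]
    _ ≤ 4 := by linarith

/-- Energy bound `∫‖v‖² ≤ 16`. [folklore] -/
theorem integral_norm_sq_vfield_le : ∫ x, ‖vfield x‖ ^ 2 ≤ 16 := by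
  have hpt : ∀ x, ‖vfield x‖ ^ 2 ≤ (16 : ℝ) := fun x => by
    have h := norm_vfield_le x
    have h0 := norm_nonneg (vfield x)
    nlinarith
  calc ∫ x, ‖vfield x‖ ^ 2 ≤ ∫ _x : UnitAddTorus (Fin 3), (16 : ℝ) :=
        integral_mono_of_nonneg (Filter.Eventually.of_forall fun _ => sq_nonneg _) (integrable_const _)
          (Filter.Eventually.of_forall hpt)
    _ = 16 := by simp


/-- Defect of the scaled field along one direction: `c²·c_K²/16 ≤ ½∫₀¹∫‖(c v)(x + s(a,0,b)) - (c v)(x)‖²`. [folklore] -/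
theorem defect_smul_vfield_ge (c : ℝ) (a b : ℤ) (hab : (a, b) ≠ (0, 0)) :
    c ^ 2 * (cK ^ 2 / 16) ≤ (1 / 2 : ℝ) * ∫ s in (0 : ℝ)..1, ∫ x, ‖(c • vfield) (x + Literature.Analysis.FluidPDE.toTorus
      (fun i => s * (![(a : ℝ), 0, (b : ℝ)] : Fin 3 → ℝ) i)) - (c • vfield) x‖ ^ 2 := by
  have hpt : ∀ (s : ℝ) (x : UnitAddTorus (Fin 3)),
      ‖(c • vfield) (x + Literature.Analysis.FluidPDE.toTorus (fun i => s * (![(a : ℝ), 0, (b : ℝ)] : Fin 3 → ℝ) i)) -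
        (c • vfield) x‖ ^ 2 =
      c ^ 2 * ‖vfield (x + Literature.Analysis.FluidPDE.toTorus (fun i => s * (![(a : ℝ), 0, (b : ℝ)] : Fin 3 → ℝ) i)) -
        vfield x‖ ^ 2 := by
    intro s x
    rw [Pi.smul_apply, Pi.smul_apply, ← smul_sub, norm_smul, mul_pow, Real.norm_eq_abs, sq_abs]
  simp_rw [hpt, integral_const_mul, intervalIntegral.integral_const_mul]
  have h := defect_vfield_ge a b hab
  have hc : 0 ≤ c ^ 2 := sq_nonneg c
  calc c ^ 2 * (cK ^ 2 / 16)
      ≤ c ^ 2 * ((1 / 2 : ℝ) * ∫ s in (0 : ℝ)..1, ∫ x, ‖vfield (x + Literature.Analysis.FluidPDE.toTorus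
          (fun i => s * (![(a : ℝ), 0, (b : ℝ)] : Fin 3 → ℝ) i)) - vfield x‖ ^ 2) :=
        mul_le_mul_of_nonneg_left h hc
    _ = _ := by ring

/-- The lineage's instantaneous planar-symmetry defect of the scaled field is `≥ c² c_K²/16`. [folklore] -/
theorem defect_iInf_smul_vfield_ge (c : ℝ) :
    c ^ 2 * (cK ^ 2 / 16) ≤ ⨅ q : {q : ℤ × ℤ // q ≠ 0}, (1 / 2 : ℝ) * ∫ s in (0 : ℝ)..1, ∫ x,
      ‖(c • vfield) (x + Literature.Analysis.FluidPDE.toTorus (fun i => s * (![((q.1.1 : ℤ) : ℝ), 0, ((q.1.2 : ℤ) : ℝ)] :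
        Fin 3 → ℝ) i)) - (c • vfield) x‖ ^ 2 := by
  haveI : Nonempty {q : ℤ × ℤ // q ≠ 0} := ⟨⟨(1, 0), by simp⟩⟩
  refine le_ciInf fun q => ?_
  obtain ⟨⟨a, b⟩, hq⟩ := q
  exact defect_smul_vfield_ge c a b hq

/-! ## §2 The core lemma: any Leray–Hopf solution ejects at `t = 0` after a change of its free slice -/

/-- **Slice-zero ejection.**  For every global Leray–Hopf solution `v` from an `L²` datum `v₀` of positive
energy (any viscosity, any force; no integrability of the datum is needed) there is a global Leray–Hopf solution `u` FROM THE SAME DATUM whose time-zero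
slice has positive planar-symmetry defect, at least `c_K²/256` times its energy: `u = v` on `t > 0`,
`u 0 = c • vfield` with `c² = ∫‖v₀‖²/16`. [folklore] -/
theorem sliceZero_eject {ν : ℝ} {F : ℝ → UnitAddTorus (Fin 3) → EuclideanSpace ℝ (Fin 3)}
    {v₀ : UnitAddTorus (Fin 3) → EuclideanSpace ℝ (Fin 3)} {v : ℝ → UnitAddTorus (Fin 3) → EuclideanSpace ℝ (Fin 3)}
    (hv : IsGlobalLerayHopf ν F v₀ v) (hpos : 0 < ∫ x, ‖v₀ x‖ ^ 2) :
    ∃ u : ℝ → UnitAddTorus (Fin 3) → EuclideanSpace ℝ (Fin 3), IsGlobalLerayHopf ν F v₀ u ∧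
      0 < (⨅ q : {q : ℤ × ℤ // q ≠ 0}, (1 / 2 : ℝ) * ∫ s in (0 : ℝ)..1, ∫ x, ‖u 0 (x + Literature.Analysis.FluidPDE.toTorus
        (fun i => s * (![((q.1.1 : ℤ) : ℝ), 0, ((q.1.2 : ℤ) : ℝ)] : Fin 3 → ℝ) i)) - u 0 x‖ ^ 2) ∧
      cK ^ 2 / 256 * ∫ x, ‖u 0 x‖ ^ 2 ≤ (⨅ q : {q : ℤ × ℤ // q ≠ 0}, (1 / 2 : ℝ) * ∫ s in (0 : ℝ)..1, ∫ x,
        ‖u 0 (x + Literature.Analysis.FluidPDE.toTorus (fun i => s * (![((q.1.1 : ℤ) : ℝ), 0, ((q.1.2 : ℤ) : ℝ)] :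
          Fin 3 → ℝ) i)) - u 0 x‖ ^ 2) := by
  set E : ℝ := ∫ x, ‖v₀ x‖ ^ 2 with hE
  set c : ℝ := Real.sqrt (E / 16) with hc
  have hc2 : c ^ 2 = E / 16 := Real.sq_sqrt (by positivity)
  set W : UnitAddTorus (Fin 3) → EuclideanSpace ℝ (Fin 3) := c • vfield with hW
  have hWsm : IsSmooth W := isSmooth_vfield.smul c
  -- energy of the junk slice
  have hWint : ∫ x, ‖W x‖ ^ 2 = c ^ 2 * ∫ x, ‖vfield x‖ ^ 2 := by
    rw [← integral_const_mul]
    refine integral_congr_ae (Filter.Eventually.of_forall fun x => ?_)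
    simp only [hW, Pi.smul_apply, norm_smul, mul_pow, Real.norm_eq_abs, sq_abs]
  have hWE : ∫ x, ‖W x‖ ^ 2 ≤ E := by
    rw [hWint, hc2]
    have := integral_norm_sq_vfield_le
    have hE0 : 0 ≤ E := le_of_lt hpos
    nlinarith
  set u : ℝ → UnitAddTorus (Fin 3) → EuclideanSpace ℝ (Fin 3) := update v 0 W with hu
  have hu0 : u 0 = W := by simp [hu]
  have hut : ∀ t, 0 < t → u t = v t := fun t ht => by simp [hu, ht.ne']
  refine ⟨u, ?_, ?_, ?_⟩
  · refine hv.congr_of_eqOn_Ioi hut ?_ ?_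
    · rw [hu0]; exact hWsm.memLp 2
    · rw [hu0]
      unfold kineticEnergy
      exact mul_le_mul_of_nonneg_left hWE (by norm_num)
  · rw [hu0]
    refine lt_of_lt_of_le ?_ (defect_iInf_smul_vfield_ge c)
    have hcK : cK ≠ 0 := fun h => by have := four_pi_mul_cK; rw [h, mul_zero] at this; norm_num at this
    have : 0 < cK ^ 2 := lt_of_le_of_ne (sq_nonneg _) (Ne.symm (pow_ne_zero 2 hcK))
    rw [hc2]
    positivity
  · rw [hu0]
    refine le_trans ?_ (defect_iInf_smul_vfield_ge c)
    rw [hc2]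
    have hK : 0 ≤ cK ^ 2 := sq_nonneg _
    calc cK ^ 2 / 256 * ∫ x, ‖W x‖ ^ 2 ≤ cK ^ 2 / 256 * E := mul_le_mul_of_nonneg_left hWE (by positivity)
      _ = E / 16 * (cK ^ 2 / 16) := by ring

/-- The constant `c_K²/256` is positive. [folklore] -/
theorem c0_pos : 0 < cK ^ 2 / 256 := by
  have hcK : cK ≠ 0 := fun h => by have := four_pi_mul_cK; rw [h, mul_zero] at this; norm_num at this
  have : 0 < cK ^ 2 := lt_of_le_of_ne (sq_nonneg _) (Ne.symm (pow_ne_zero 2 hcK))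
  positivity

end Summit.AnomalousDissipation.AnomalousDissipation.Theorems.SymmetricOrLoudPlanarStatesEject.Negative

end
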